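import Mathlib.Analysis.Complex.Schwarz
import Summits.QuantumFields.BalabanUV.T4Continuum.Spine.NE7.QLaCriticality

/-!
# Spine/NE7/QLaRescaledSource — reading (b)'s law half by SOURCE RESCALING: a ledger term that depends on the source `t` only
# through a rider of range `s` is a function of `τ = t·s`; if it is analytic and bounded by `B` for `|τ| < 1`, its
# `t`-discrepancy is at most `2·B·s·|t|` (Schwarz) — the defect factor `s` of NODE S WITHOUT the sandwich, for SIGNED terms

Cell `pub-balaban-gaps` (YM blitz Y1, track G2, seat `ne7`, generation 10); text of record
`run/shared/lean/pub/pub-balaban-gaps/ne/NE7.md` (v10: §4undecies (vi)(α), census R66).  39th `Spine/NE7/` file; 0 `def`, 0 sorry.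

WHY.  Files 36–38 left ONE named gap in reading (b) of NODE S's ledger (constants indexed by the localization domains of the
exponentiated form [Balaban1989LargeFieldI] (0.5)–(0.6)): the terms `𝐑(X)` of a cluster ∕ Mayer re-expansion are SIGNED, so the
monotone sandwich of file 37 (`abs_log_tiltedQuotient_sub_le`) does not apply term by term.  What does apply is the oldest
device of the cell's route 1 (T.2, `TermwiseAnalyticMarginLayered`: the term data are ANALYTIC in auxiliary parameters with a
margin): at the trivial exterior the source enters every fibre integral only through the rider `e^{t·G}` with `|G| ≤ s` (NODE S's
defect, `abs_rider_le_of_support`), i.e. through `e^{(t·s)·(G∕s)}` with `|G∕s| ≤ 1` — so a term is a function `b(τ)` of the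
RESCALED source `τ = t·s`, and a bound `‖b(τ)‖ ≤ B` uniform over riders of range `≤ 1` and `|τ| < 1` (the kind of uniformity a
convergent expansion delivers for bounded complex riders) gives, by the Schwarz lemma (Mathlib
`Complex.dist_le_div_mul_dist_of_mapsTo_ball`), `‖b(τ) − b(0)‖ ≤ 2B·|τ|`, i.e. `|c_t(X) − c_0(X)| ≤ 2·B_X·s_X·|t|`: the defect factor
`s_X` (second order in the age at `U = 1`, files 5∕29∕33) times the term's own size `B_X` (which carries the printed decay
`exp(−κ d_k(X))`, [Balaban1989LargeFieldII] (1.100)) — exactly the binder `hdef` of `qlaPt_of_defect` with weight `B_X·wt X`, whose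
census is file 38's.  §1 is the Schwarz step for a bounded analytic function on the unit disc; §2 the rescaling; §3 the hand-off to
`Spine.NE7.QLaPt` ∕ `QLa` in the second-order currency.

HONEST FRAMING.  Complex analysis of one bounded analytic function; every declaration is [folklore]; the analyticity-with-margin of
Bałaban's exponentiated terms in the rider strength is a HYPOTHESIS here (its printed relatives are the analyticity statements of
[Balaban1987RG1] §2 ∕ [Balaban1989LargeFieldII] §1 in complex field translations, NOT in an observable source — the dressed case is
deferred in print, [Balaban1989LargeFieldII] p. 356); nothing of Bałaban's is asserted.  NE7 NOT proved; spine 0∕9; one fixed finite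
T⁴ — NOT ℝ⁴, NOT infinite volume, NOT a mass gap, NOT Clay.  No classification word moves (R10).
-/

noncomputable section

open Metric Set Complex Finset
open scoped BigOperators

namespace Summit.QuantumFields.BalabanUV.T4Continuum.Spine.NE7

/-! ## §1 Schwarz: a bounded analytic function on the unit disc moves by at most `2B·|τ|` -/

section Schwarz

/-- **BOUNDED ANALYTIC ⟹ LIPSCHITZ AT THE CENTRE** (Schwarz lemma): `b` differentiable on the open unit disc with `‖b τ‖ ≤ B`
there ⟹ `‖b τ − b 0‖ ≤ 2B·‖τ‖` for `‖τ‖ < 1` (the disc is mapped into the closed ball of radius `2B` about `b 0`). [folklore] -/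
theorem norm_sub_le_two_mul_of_bounded_analytic {b : ℂ → ℂ} {B : ℝ} (hd : DifferentiableOn ℂ b (ball 0 1))
    (hB : ∀ τ ∈ ball (0 : ℂ) 1, ‖b τ‖ ≤ B) {τ : ℂ} (hτ : ‖τ‖ < 1) : ‖b τ - b 0‖ ≤ 2 * B * ‖τ‖ := by
  have hτ' : τ ∈ ball (0 : ℂ) 1 := by rwa [mem_ball, dist_zero_right]
  have h0 : (0 : ℂ) ∈ ball (0 : ℂ) 1 := mem_ball_self zero_lt_one
  have hmaps : MapsTo b (ball 0 1) (closedBall (b 0) (2 * B)) := fun z hz => by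
    rw [mem_closedBall, dist_eq_norm]
    calc ‖b z - b 0‖ ≤ ‖b z‖ + ‖b 0‖ := norm_sub_le _ _
      _ ≤ B + B := add_le_add (hB z hz) (hB 0 h0)
      _ = 2 * B := by ring
  have h := dist_le_div_mul_dist_of_mapsTo_ball hd hmaps hτ'
  rwa [dist_eq_norm, dist_zero_right, div_one] at h

/-- Real form: for a real source `τ` with `|τ| < 1`, `|Re b τ − Re b 0| ≤ 2B·|τ|`. [folklore] -/
theorem abs_re_sub_le_of_bounded_analytic {b : ℂ → ℂ} {B : ℝ} (hd : DifferentiableOn ℂ b (ball 0 1))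
    (hB : ∀ τ ∈ ball (0 : ℂ) 1, ‖b τ‖ ≤ B) {τ : ℝ} (hτ : |τ| < 1) : |(b τ).re - (b 0).re| ≤ 2 * B * |τ| := by
  have hτc : ‖(τ : ℂ)‖ < 1 := by rwa [norm_real, Real.norm_eq_abs]
  have h := norm_sub_le_two_mul_of_bounded_analytic hd hB hτc
  rw [norm_real, Real.norm_eq_abs] at h
  calc |(b τ).re - (b 0).re| = |(b τ - b 0).re| := by rw [sub_re]
    _ ≤ ‖b τ - b 0‖ := abs_re_le_norm _
    _ ≤ 2 * B * |τ| := h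

end Schwarz

/-! ## §2 Rescaling the source by the rider's range -/

section Rescale

/-- **SOURCE RESCALING.**  If a term at source `t` is `Re b(t·s)` for a function `b` of the rescaled source (the rider enters as
`e^{(t·s)·(G∕s)}`, `|G∕s| ≤ 1`), `b` analytic and bounded by `B` on the unit disc, then for `|t|·s < 1`:
`|c_t − c_0| ≤ 2·B·s·|t|` — the DEFECT FACTOR `s` appears linearly, for a SIGNED term, with no monotonicity used. [folklore] -/
theorem abs_sub_le_of_rescaled {b : ℂ → ℂ} {B s t : ℝ} (hd : DifferentiableOn ℂ b (ball 0 1))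
    (hB : ∀ τ ∈ ball (0 : ℂ) 1, ‖b τ‖ ≤ B) (hs : 0 ≤ s) (hts : |t| * s < 1) {ct c0 : ℝ} (hct : ct = (b (t * s)).re)
    (hc0 : c0 = (b 0).re) : |ct - c0| ≤ 2 * B * s * |t| := by
  have hτ : |t * s| < 1 := by rwa [abs_mul, abs_of_nonneg hs]
  have h := abs_re_sub_le_of_bounded_analytic hd hB hτ
  rw [hct, hc0]
  push_cast at h ⊢
  calc |(b (↑t * ↑s)).re - (b 0).re| ≤ 2 * B * |t * s| := by exact_mod_cast h
    _ = 2 * B * s * |t| := by rw [abs_mul, abs_of_nonneg hs]; ring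

end Rescale

/-! ## §3 Hand-off to NODE S's currency: `QLaPt` with weight `size × wt`, second order in the age -/

section HandOff

variable {D : Type*}

/-- **READING (b)'s PER-ENTRY BOUND.**  A ledger `wf` with scales `sc`; for each entry `X` a function `b X` of the rescaled source,
analytic and bounded by `Bsz X` on the unit disc (the term's SIZE, carrying the printed decay), a rider range
`s X ≤ Cd·wt X·(θ^{K − sc X})²` (NODE S's defect on the entry's support), `|t| ≤ l₀` with `l₀·s X < 1`, and the identities
`c_t(X) = Re b X (t·s X)`, `c_0(X) = Re b X 0`.  Then `Spine.NE7.QLaPt wf sc (fun X => Bsz X * wt X) ct c0 K (2·l₀·Cd) (θ²)`: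
the per-component shape of p340302 in the SECOND-order currency with weight size × support weight — whose census is file 38's
(decayed connected domains) and whose ratio after `qla_of_pt_multiplicity` is `θ²·Λ` (`= L⁻²` in d = 4). [folklore] -/
theorem qlaPt_of_rescaled {wf : Finset D} {sc : D → ℕ} {wt ct c0 s Bsz : D → ℝ} {b : D → ℂ → ℂ} {K : ℕ}
    {l₀ Cd θ t : ℝ} (ht : |t| ≤ l₀) (hCd : 0 ≤ Cd) (hwt : ∀ X ∈ wf, 0 ≤ wt X) (hB : ∀ X ∈ wf, 0 ≤ Bsz X)
    (hd : ∀ X ∈ wf, DifferentiableOn ℂ (b X) (ball 0 1)) (hbB : ∀ X ∈ wf, ∀ τ ∈ ball (0 : ℂ) 1, ‖b X τ‖ ≤ Bsz X)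
    (hs0 : ∀ X ∈ wf, 0 ≤ s X) (hsl : ∀ X ∈ wf, l₀ * s X < 1) (hs : ∀ X ∈ wf, s X ≤ Cd * wt X * (θ ^ (K - sc X)) ^ 2)
    (hct : ∀ X ∈ wf, ct X = (b X (t * s X)).re) (hc0 : ∀ X ∈ wf, c0 X = (b X 0).re) :
    QLaPt wf sc (fun X => Bsz X * wt X) ct c0 K (2 * l₀ * Cd) (θ ^ 2) := by
  intro X hX
  show |ct X - c0 X| ≤ 2 * l₀ * Cd * (Bsz X * wt X) * (θ ^ 2) ^ (K - sc X)
  have hts : |t| * s X < 1 := (mul_le_mul_of_nonneg_right ht (hs0 X hX)).trans_lt (hsl X hX)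
  have h1 := abs_sub_le_of_rescaled (hd X hX) (hbB X hX) (hs0 X hX) hts (hct X hX) (hc0 X hX)
  refine h1.trans ?_
  have hpow2 : (θ ^ (K - sc X)) ^ 2 = (θ ^ 2) ^ (K - sc X) := by rw [← pow_mul, ← pow_mul, mul_comm]
  have hpow : 0 ≤ (θ ^ 2) ^ (K - sc X) := pow_nonneg (sq_nonneg θ) _
  have h2 : s X ≤ Cd * wt X * (θ ^ 2) ^ (K - sc X) := hpow2 ▸ hs X hX
  calc 2 * Bsz X * s X * |t| ≤ 2 * Bsz X * (Cd * wt X * (θ ^ 2) ^ (K - sc X)) * l₀ := by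
        refine mul_le_mul (mul_le_mul_of_nonneg_left h2 (mul_nonneg zero_le_two (hB X hX))) ht (abs_nonneg t) ?_
        exact mul_nonneg (mul_nonneg zero_le_two (hB X hX)) (mul_nonneg (mul_nonneg hCd (hwt X hX)) hpow)
    _ = 2 * l₀ * Cd * (Bsz X * wt X) * (θ ^ 2) ^ (K - sc X) := by ring

end HandOff

end Summit.QuantumFields.BalabanUV.T4Continuum.Spine.NE7

end
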